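import Summits.HubbardSuperconductivity.HubbardSuperconductivity.Theorems.AposterioriCapRgSeededBrokenRegimeBoseFermiPinnedLegKernelNormAddLe
import Literature.MathematicalPhysics.QuantumLattice.GrassmannKernels
import Mathlib.Analysis.Calculus.MeanValue

/-!
# The flow-step inequality in the leg-weighted `L¹–L^∞` norm
# (crux `SeededBrokenRegimeBoseFermiPinned` = stmt-HubbardSuperconductivity-14047, route AposterioriCapRg; supports, lead c4)

Restatement-invariant analysis layer: the MEAN-VALUE STEP that turns a weak flow equation (Polchinski's equation holds
through every linear functional: `hasDerivAt_apply_effAction`, `seedFlow_/scaleFlow_hubbardEffectiveActionCT`, landed)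
plus the `L¹–L^∞` estimates of its right-hand side (`…LaplacianNormBound`, `…PolchinskiBilinearBound`) into a bound on the
INCREMENT of the effective action over a flow interval, degree by degree, in the leg-weighted norm of the route's
scale report:

  if `∂_t φ(𝒢_t) = φ(R_t)` for all functionals `φ` on `[s₀, s₁]` and `‖(R_t)_m‖_{wt,ε} ≤ B` there, then
  `‖(𝒢_{s₁} − 𝒢_{s₀})_m‖_{wt,ε} ≤ (s₁ − s₀) · B`.

Proof without any norm on the Grassmann algebra: a pinned weighted `ℓ¹` sum `Σ_X c_X ‖Δ_X‖` of kernel increments is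
the value of ONE linear functional `Ψ = Σ_X c_X ū_X · kernel_X` (phases `u_X = Δ_X/‖Δ_X‖`) on `𝒢_{s₁} − 𝒢_{s₀}`, so the
scalar mean value inequality (`norm_image_sub_le_of_norm_deriv_le_segment'`) applies to `t ↦ Ψ(𝒢_t)`, whose derivative
`Ψ(R_t)` is bounded by the pinned sum of `R_t`, hence by its norm.

Sources: M. Salmhofer, *Renormalization* (1999), §4.4 (integrating the flow in the norm); folklore (duality for `ℓ¹`).
-/

set_option linter.dupNamespace false -- `Summit.<S>.<S>` doubles the summit name (tree convention)

namespace Summit.HubbardSuperconductivity.HubbardSuperconductivity.Theorems.AposterioriCapRgSeededBrokenRegimeBoseFermiPinned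

open Literature.MathematicalPhysics.QuantumLattice GrassmannAlgebra

namespace FlowStep

variable {Γ : Type*}

/-- Salmhofer's weighted kernel at a fixed word is a LINEAR FUNCTIONAL of the polynomial:
`weightedKernel ε F m X = (c • constPart ∘ iterDeriv X) F`. [folklore] -/
theorem weightedKernel_eq_linearMap_apply (ε : ℝ) (m : ℕ) (X : Fin m → Γ) (F : GrassmannAlgebra ℂ Γ) :
    weightedKernel ε F m X =
      (((((ε⁻¹ ^ m : ℝ) : ℂ) * ((m.factorial : ℚ)⁻¹ • (1 : ℂ))) : ℂ) •
        ((constPart ℂ (Γ := Γ)).toLinearMap ∘ₗ iterDeriv ℂ X)) F := by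
  rw [weightedKernel_def, kernel_def, LinearMap.smul_apply, LinearMap.comp_apply, smul_eq_mul, mul_assoc]
  rfl

/-- The phase of a complex number as a contraction: `‖phase z‖ ≤ 1` and `phase z * z = ‖z‖`, with
`phase z = conj z / ‖z‖` (`0` at `0`). [folklore] -/
theorem exists_phase (z : ℂ) : ∃ u : ℂ, ‖u‖ ≤ 1 ∧ u * z = (‖z‖ : ℂ) := by
  by_cases hz : z = 0
  · exact ⟨0, by simp, by simp [hz]⟩
  · refine ⟨(starRingEnd ℂ) z / (‖z‖ : ℂ), ?_, ?_⟩
    · rw [norm_div, Complex.norm_conj, Complex.norm_real, Real.norm_eq_abs, abs_norm, div_self (norm_ne_zero_iff.2 hz)]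
    · rw [div_mul_eq_mul_div, Complex.conj_mul', ← Complex.ofReal_pow, sq, Complex.ofReal_mul,
        mul_div_assoc, div_self (Complex.ofReal_ne_zero.2 (norm_ne_zero_iff.2 hz)), mul_one]

variable [Fintype Γ] [DecidableEq Γ]

/-- **The mean-value step for one pinned fibre**: if `t ↦ φ(𝒢_t)` has derivative `φ(R_t)` on `[s₀, s₁]` for every
linear functional `φ`, and the leg-weighted norm of `(R_t)_{k+1}` is at most `B` there, then every weighted pinned sum of
the kernel increment `(𝒢_{s₁} − 𝒢_{s₀})_{k+1}` is at most `B · (s₁ − s₀)` (duality: the pinned `ℓ¹` sum is the value of one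
functional). [folklore] -/
theorem pinnedSum_increment_le {wt : Γ → ℝ} (hwt : ∀ X, 0 ≤ wt X) {ε : ℝ} (hε : 0 ≤ ε)
    (𝒢 R : ℝ → GrassmannAlgebra ℂ Γ) {s₀ s₁ : ℝ} (hs : s₀ ≤ s₁)
    (hder : ∀ s ∈ Set.Icc s₀ s₁, ∀ φ : GrassmannAlgebra ℂ Γ →ₗ[ℂ] ℂ, HasDerivAt (fun t => φ (𝒢 t)) (φ (R s)) s)
    (k : ℕ) {B : ℝ} (hB : ∀ s ∈ Set.Icc s₀ s₁, legKernelNorm wt ε (k + 1) (weightedKernel ε (R s) (k + 1)) ≤ B)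
    (p : Fin (k + 1)) (x : Γ) :
    ε ^ k * ∑ X ∈ Finset.univ.filter (fun X : Fin (k + 1) → Γ => X p = x),
        (∏ q, wt (X q)) * ‖weightedKernel ε (𝒢 s₁ - 𝒢 s₀) (k + 1) X‖ ≤ B * (s₁ - s₀) := by
  classical
  -- phases realising the norms of the increments
  choose u hu using fun X : Fin (k + 1) → Γ => exists_phase (weightedKernel ε (𝒢 s₁ - 𝒢 s₀) (k + 1) X)
  -- the kernel functionals and the dual functional `Ψ`
  set L : (Fin (k + 1) → Γ) → (GrassmannAlgebra ℂ Γ →ₗ[ℂ] ℂ) := fun X =>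
    (((((ε⁻¹ ^ (k + 1) : ℝ) : ℂ) * (((k + 1).factorial : ℚ)⁻¹ • (1 : ℂ))) : ℂ) •
      ((constPart ℂ (Γ := Γ)).toLinearMap ∘ₗ iterDeriv ℂ X)) with hLdef
  have hL : ∀ (F : GrassmannAlgebra ℂ Γ) (X : Fin (k + 1) → Γ), weightedKernel ε F (k + 1) X = L X F :=
    fun F X => weightedKernel_eq_linearMap_apply ε (k + 1) X F
  set S : Finset (Fin (k + 1) → Γ) := Finset.univ.filter (fun X : Fin (k + 1) → Γ => X p = x) with hSdef
  set Ψ : GrassmannAlgebra ℂ Γ →ₗ[ℂ] ℂ := ∑ X ∈ S, ((((ε ^ k * ∏ q, wt (X q) : ℝ)) : ℂ) * u X) • L X with hΨdef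
  have hΨ : ∀ F : GrassmannAlgebra ℂ Γ,
      Ψ F = ∑ X ∈ S, (((ε ^ k * ∏ q, wt (X q) : ℝ)) : ℂ) * u X * weightedKernel ε F (k + 1) X := by
    intro F
    rw [hΨdef, LinearMap.sum_apply]
    exact Finset.sum_congr rfl fun X _ => by rw [LinearMap.smul_apply, smul_eq_mul, hL]
  -- weak differentiability along `Ψ`, and the bound on the derivative
  have hd : ∀ t ∈ Set.Icc s₀ s₁, HasDerivWithinAt (fun t => Ψ (𝒢 t)) (Ψ (R t)) (Set.Icc s₀ s₁) t :=
    fun t ht => (hder t ht Ψ).hasDerivWithinAt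
  have hw0 : ∀ X : Fin (k + 1) → Γ, 0 ≤ ε ^ k * ∏ q, wt (X q) :=
    fun X => mul_nonneg (pow_nonneg hε k) (Finset.prod_nonneg fun q _ => hwt _)
  have hbd : ∀ t ∈ Set.Ico s₀ s₁, ‖Ψ (R t)‖ ≤ B := by
    intro t ht
    rw [hΨ]
    calc ‖∑ X ∈ S, (((ε ^ k * ∏ q, wt (X q) : ℝ)) : ℂ) * u X * weightedKernel ε (R t) (k + 1) X‖
        ≤ ∑ X ∈ S, (ε ^ k * ∏ q, wt (X q)) * ‖weightedKernel ε (R t) (k + 1) X‖ := by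
          refine (norm_sum_le _ _).trans (Finset.sum_le_sum fun X _ => ?_)
          rw [norm_mul, norm_mul, Complex.norm_real, Real.norm_eq_abs, abs_of_nonneg (hw0 X)]
          refine mul_le_mul_of_nonneg_right ?_ (norm_nonneg _)
          calc (ε ^ k * ∏ q, wt (X q)) * ‖u X‖ ≤ (ε ^ k * ∏ q, wt (X q)) * 1 :=
                mul_le_mul_of_nonneg_left (hu X).1 (hw0 X)
            _ = ε ^ k * ∏ q, wt (X q) := mul_one _
      _ = ε ^ k * ∑ X ∈ S, (∏ q, wt (X q)) * ‖weightedKernel ε (R t) (k + 1) X‖ := by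
          rw [Finset.mul_sum]
          exact Finset.sum_congr rfl fun X _ => mul_assoc _ _ _
      _ ≤ legKernelNorm wt ε (k + 1) (weightedKernel ε (R t) (k + 1)) :=
          LegKernelNormAlgebra.pinnedSum_le_legKernelNorm wt ε k _ p x
      _ ≤ B := hB t (Set.Ico_subset_Icc_self ht)
  -- the mean value inequality
  have hmvt := norm_image_sub_le_of_norm_deriv_le_segment' hd hbd s₁ (Set.right_mem_Icc.2 hs)
  -- the value of `Ψ` on the increment is the pinned sum
  have hval : Ψ (𝒢 s₁) - Ψ (𝒢 s₀) =
      ((ε ^ k * ∑ X ∈ S, (∏ q, wt (X q)) * ‖weightedKernel ε (𝒢 s₁ - 𝒢 s₀) (k + 1) X‖ : ℝ) : ℂ) := by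
    rw [← map_sub, hΨ, Finset.mul_sum, Complex.ofReal_sum]
    refine Finset.sum_congr rfl fun X _ => ?_
    rw [mul_assoc, (hu X).2]
    push_cast
    ring
  have hreal : ‖Ψ (𝒢 s₁) - Ψ (𝒢 s₀)‖ =
      ε ^ k * ∑ X ∈ S, (∏ q, wt (X q)) * ‖weightedKernel ε (𝒢 s₁ - 𝒢 s₀) (k + 1) X‖ := by
    rw [hval, Complex.norm_real, Real.norm_eq_abs, abs_of_nonneg]
    exact mul_nonneg (pow_nonneg hε k)
      (Finset.sum_nonneg fun X _ => mul_nonneg (Finset.prod_nonneg fun q _ => hwt _) (norm_nonneg _))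
  rw [← hreal]
  exact hmvt

/-- **The flow-step inequality** (generic finite label type): under the hypotheses of `pinnedSum_increment_le`,
`‖(𝒢_{s₁} − 𝒢_{s₀})_m‖_{wt,ε} ≤ (s₁ − s₀) · B` in every degree `m`. [cite: Salmhofer1999, §4.4] -/
theorem legKernelNorm_increment_le {wt : Γ → ℝ} (hwt : ∀ X, 0 ≤ wt X) {ε : ℝ} (hε : 0 ≤ ε)
    (𝒢 R : ℝ → GrassmannAlgebra ℂ Γ) {s₀ s₁ : ℝ} (hs : s₀ ≤ s₁)
    (hder : ∀ s ∈ Set.Icc s₀ s₁, ∀ φ : GrassmannAlgebra ℂ Γ →ₗ[ℂ] ℂ, HasDerivAt (fun t => φ (𝒢 t)) (φ (R s)) s)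
    (m : ℕ) {B : ℝ} (hB : ∀ s ∈ Set.Icc s₀ s₁, legKernelNorm wt ε m (weightedKernel ε (R s) m) ≤ B) :
    legKernelNorm wt ε m (weightedKernel ε (𝒢 s₁ - 𝒢 s₀) m) ≤ (s₁ - s₀) * B := by
  have hB0 : 0 ≤ B := (legKernelNorm_nonneg hwt hε m _).trans (hB s₀ (Set.left_mem_Icc.2 hs))
  cases m with
  | zero =>
    -- degree `0`: one functional, the scalar mean value inequality
    rw [legKernelNorm_zero_left]
    set L0 : GrassmannAlgebra ℂ Γ →ₗ[ℂ] ℂ :=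
      (((((ε⁻¹ ^ 0 : ℝ) : ℂ) * (((0 : ℕ).factorial : ℚ)⁻¹ • (1 : ℂ))) : ℂ) •
        ((constPart ℂ (Γ := Γ)).toLinearMap ∘ₗ iterDeriv ℂ (Fin.elim0 : Fin 0 → Γ))) with hL0def
    have hL0 : ∀ F : GrassmannAlgebra ℂ Γ, weightedKernel ε F 0 Fin.elim0 = L0 F :=
      fun F => weightedKernel_eq_linearMap_apply ε 0 Fin.elim0 F
    have hd : ∀ t ∈ Set.Icc s₀ s₁, HasDerivWithinAt (fun t => L0 (𝒢 t)) (L0 (R t)) (Set.Icc s₀ s₁) t :=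
      fun t ht => (hder t ht L0).hasDerivWithinAt
    have hbd : ∀ t ∈ Set.Ico s₀ s₁, ‖L0 (R t)‖ ≤ B := fun t ht => by
      rw [← hL0, ← legKernelNorm_zero_left wt ε]
      exact hB t (Set.Ico_subset_Icc_self ht)
    have hmvt := norm_image_sub_le_of_norm_deriv_le_segment' hd hbd s₁ (Set.right_mem_Icc.2 hs)
    rw [hL0, map_sub, mul_comm]
    exact hmvt
  | succ k =>
    refine LegKernelNormAlgebra.legKernelNorm_succ_le_of_forall wt ε k _ (mul_nonneg (sub_nonneg.2 hs) hB0)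
      fun p x => ?_
    exact (pinnedSum_increment_le hwt hε 𝒢 R hs hder k hB p x).trans_eq (mul_comm _ _)

end FlowStep

/-! ### The registered stub -/

/-- **W9 (`stub_legKernelNormFlowStepLe`) — the flow-step inequality**: if Polchinski's (or any) flow equation holds
weakly on `[s₀, s₁]`, `∂_t φ(𝒢_t) = φ(R_t)` for every linear functional `φ`, and `‖(R_t)_m‖_{wt,ε} ≤ B` there, then
`‖(𝒢_{s₁} − 𝒢_{s₀})_m‖_{wt,ε} ≤ (s₁ − s₀) · B` (leg-weighted `L¹–L^∞` norm of Salmhofer's kernels, every degree `m`).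
[cite: Salmhofer1999, §4.4] -/
theorem stub_legKernelNormFlowStepLe :
    ∀ {Γ : Type} [Fintype Γ] [DecidableEq Γ] (wt : Γ → ℝ), (∀ X, 0 ≤ wt X) → ∀ {ε : ℝ}, 0 ≤ ε →
      ∀ (𝒢 R : ℝ → GrassmannAlgebra ℂ Γ) (s₀ s₁ : ℝ), s₀ ≤ s₁ →
        (∀ s ∈ Set.Icc s₀ s₁, ∀ φ : GrassmannAlgebra ℂ Γ →ₗ[ℂ] ℂ, HasDerivAt (fun t => φ (𝒢 t)) (φ (R s)) s) →
        ∀ (m : ℕ) (B : ℝ), (∀ s ∈ Set.Icc s₀ s₁, legKernelNorm wt ε m (weightedKernel ε (R s) m) ≤ B) →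
          legKernelNorm wt ε m (weightedKernel ε (𝒢 s₁ - 𝒢 s₀) m) ≤ (s₁ - s₀) * B := by
  intro Γ _ _ wt hwt ε hε 𝒢 R s₀ s₁ hs hder m B hB
  exact FlowStep.legKernelNorm_increment_le hwt hε 𝒢 R hs hder m hB


end Summit.HubbardSuperconductivity.HubbardSuperconductivity.Theorems.AposterioriCapRgSeededBrokenRegimeBoseFermiPinned
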